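/-
Copyright (c) 2026 the pub-hodgecm-mathlib formalisation cell (harness21).  Prover seat hodgecm-mathlib-K2Liu-p09 (g9), Track B «K2-LIT» ∕ hLiu418
#184♮, #42S BLOCK D row D-2, (σ-A) mini-road brick [A1] «corner action words», y-STAGE PAIR BY NAME (LEAD F0P6-plan (g15) RULING M-160f ∕ BATCH #227 (ii)
∕ BATCH #242; road desk K2Liu-p25 (g3) WORDS #1, #3, #5), 2026-09-05.  THEOREMS ONLY.
-/
import Summits.HodgeConjecture.HodgeConjecture.Theorems.K2LiuLocalSWCornerActionWords       -- ★ [A1] §3: `exists_ne_zero_swSectionTensorLoc_flip_siegel_nElem_mul_eq_integral`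
import Summits.HodgeConjecture.HodgeConjecture.Theorems.K2LiuLocalFourCornerFrameOfRecord    -- ★ [A1-mat] ED. 2: `blkA_blkD_flip_mul_frameConj_weylTwo` (+ ★ [A1-mat] §1–§3)
import HarnessLib

/-!
# Crux `HLiu418`, #42S block D row D-2, (σ-A) brick [A1]: THE y-STAGE CORNER PAIR `φ(w₂) · φ(u_{2e₂}(x))` BY NAME —
# `F_Φ(φ(w₂) · φ(u_{2e₂}(x)) · g) = c · ∫_{X₁} (unipOpPi c_{t′} (op(j̃(p₁,p₂)) (frameOp_{PD}⁻¹ (ω(s′(((w₁·φ(w₂))·g) ⊗ 1)) Φ))))(x₁ ⊔ 0) dx₁`,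
# the block-side letter `t′` keyed on the CLOSED-FORM conjugated skew `A · t_x · D⁻¹ = (0 0; 0 ι(d₂)·x)`

Cell `hodgecm-mathlib`, crux item hLiu418 = `stmt-HodgeConjecture-24832`; squad K2 ∕ K2Liu; helper lane `--supports stmt-HodgeConjecture-24832 --as helper`,
count-neutral.  THEOREMS ONLY (no `def`, no `instance`, no `notation`, no named-fact hypothesis, no `sorry`).

WHY.  ★ [A1] §3 `K2LiuLocalSWCornerActionWords.exists_ne_zero_swSectionTensorLoc_flip_siegel_nElem_mul_eq_integral` (this seat) is the y-stage corner word of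
the local Siegel–Weil section `F_Φ` (★ D-A `swSectionTensorLoc`) at a GENERIC word `w₁ · m · n(t) · g` — `w₁` any flip of a line `i₀`, `m ∈ P_Δ(L⁺_v)` any Siegel
element (`blkC (matA m) = 0`), `n(t)` any Siegel unipotent.  The K1a place letters ★ `K2LiuRankOneStagePlaceLetterValues.chainValues_of_placeLetter` name the corner
element through the four letters `φ X = frameConj … Q hQ (toLocalFour … X)`, `X ∈ {w₂, u_{2e₂}(x), w₁, u_{e₁−e₂}(ζ)}`, and brick [A1-mat] (★ `K2LiuLocalFourCornerFactorisation`,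
F0P2-p10 (g3); ★ `K2LiuLocalFourCornerFrameOfRecord`, F0P2-p07 (g2)) reads them through their Δ-adapted matrices at an ANTIDIAGONAL frame `D = (0 d₁; d₂ 0)`,
`Dinv = (0 d₁′; d₂′ 0)` (the frame of record `D = ½T₂⁻¹W` at a diagonal `T₂`, ★ `exists_antidiagFrame`): `φ(u_{2e₂}(x)) = n(t_x)`, `t_x = E₂₁(x) · Dinv_v`
(★ `frameConj_uLongTwo_eq_nElem`), and for any flip `w₁` of the SECOND line `w₁ · w₁ = 1` (★ `flip_mul_self`), `adapt (matA (w₁ · φ(w₂))) = diag((1 0; 0 ι d₂), (1 0; 0 ι d₁′))`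
(★ `adapt_matA_flip_mul_frameConj_weylTwo`, ★ `blkA_blkD_flip_mul_frameConj_weylTwo`).  THIS FILE docks the y-stage pair into ★ [A1] §3 BY NAME (LEAD BATCH #242: «p09 keeps
the y-stage pair (`weylTwo`, `uLongTwo`)»; the ζ-stage pair is F0P2-p07 (g2)'s sibling `K2LiuLocalSWCornerActionWordsZeta`):
* `fromBlocks_one_sub_single_one` — the flip currency of ★ `K2LiuLocalSWFlipElements.exists_flip_single` ∕ ★ `exists_flip_single_hermD` at the line `1 : Fin 2`
  (`[[1 − E₂₂, E₂₂], [E₂₂, 1 − E₂₂]]`) IS [A1-mat]'s explicit flip `[[(1 0;0 0), (0 0;0 1)], [(0 0;0 1), (1 0;0 0)]]` — one conversion, so consumers pass `hw₁` straight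
  from ★ `exists_flip_single_hermD … 1`;
* `blkC_matA_flip_mul_frameConj_weylTwo` — `blkC (matA (w₁ · φ(w₂))) = 0` (the Siegel key of ★ [A1] §3's `hmC`);
* `blkA_mul_uLongTwoBlock_mul_blkD_inv` — **`A · t_x · D⁻¹ = (0 0; 0 ι(d₂)·x)`** for `A = blkA`, `D = blkD` of `w₁ · φ(w₂)` (`d₂ d₁′ = 1` from `D · Dinv = 1`);
* `skew_cornerYBlock` — that closed form is `gramS`-skew (it is the corner `B` of `m · n(t_x) · m⁻¹ ∈ N_Δ`, ★ `skew_blkB_of_mem_unipDeltaLocal` ∘ ★ `blkB_matA_conj_nElem`),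
  so ★ `K2LiuTensorMiddleCellSiegelLetters.exists_blockSkew` supplies the block-side letter `t′` with its `hPX`;
* **`exists_ne_zero_swSectionTensorLoc_weylTwo_uLongTwo_mul_eq_integral`** — ★ [A1] §3 at `i₀ := 1`, `m := w₁ · φ(w₂)`, `n(t) := φ(u_{2e₂}(x))`: with ★ (M2a-C2a)'s
  data VERBATIM (lines `(1, 0)`, permutation frame `σ, P, PD`, `Pᵀ · gramR(𝕍 ⊗ V′) · P = T₁ ⊕ᶠ T₂ = diagonal t′`, block data `p₁ hW₁ p₂`, conductor exponent, ANY
  outer mover-implementer `m₀`), the antidiagonal frame `(D, Dinv, Q)` and a flip `w₁` of the second line, ONE `c ≠ 0` with, for every `x ∈ L_v` with `x̄ = −x`,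
  every block-side skew `t′` keyed by `P_v t′ P_v⁻¹ = reindex_ε ((0 0; 0 ι(d₂)x) ⊗ 1)`, every `g` and every `Φ`:
  `F_Φ(φ(w₂) · φ(u_{2e₂}(x)) · g) = c · ∫_{X₁} (unipOpPi c_{t′} (op(j̃(p₁,p₂)) (frameOp_{PD}⁻¹ (ω(s′(tensorEmbLoc ((w₁ · φ(w₂)) · g))) Φ))))(x₁ ⊔ 0) dμ^{⊗(M₂+M₂)}`.
Consumers: [A4-an] (an-2) `K2LiuCornerZetaStageInversion` (K2Liu-p12 (g6)), (an-3) `K2LiuLocalSWSeamOfRecord` §3 (K2Liu-p08 (g6)), [A3] FILE 2 (LH4-p07 (g12)); the Levi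
word of the vector `ω(s′(tensorEmbLoc (w₁ · φ(w₂))))` (`χ_v(ι d₂)·|ι d₂|^{…}·leviOpPi`, keys ★ `detDelta_flip_mul_frameConj_weylTwo`) and the ζ-stage pair are the sibling's.
HONEST LABEL.  Count-neutral helper: `HC_CM` is proved only modulo the 7 printed citations (2 remaining named inputs: hLiu418 = `stmt-HodgeConjecture-24832`,
h413 = `stmt-HodgeConjecture-24833`) until rung 0 closes; `hWfun`∕`hseam` stay BY VALUE (R2) per M-160f until [A1]–[A4] + (σ-C) land.

## References
* [Kudla1994] S. S. Kudla, Israel J. Math. 87 (1994), §3 Thm. 3.1.   * [Rangarao1993] R. Ranga Rao, Pacific J. Math. 157 (1993), Lemma 3.2 (3.8).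
* [MoeglinVignerasWaldspurger1987] C. Mœglin, M.-F. Vignéras, J.-L. Waldspurger, LNM 1291 (1987), Chap. 2 II.1 Rem. (3), (6), II.6.
* [HarrisKudlaSweet1996] M. Harris, S. Kudla, W. J. Sweet, J. Amer. Math. Soc. 9 (1996), §1 (1.11)–(1.12), (1.15).
-/

set_option autoImplicit false
-- the mandated namespace repeats the single-problem summit's segment (`HodgeConjecture.HodgeConjecture`)
set_option linter.dupNamespace false

noncomputable section

open scoped Matrix Kronecker
open NumberField IsDedekindDomain MeasureTheory Matrix
open Literature.RepresentationTheory.HeisenbergGroup Literature.RepresentationTheory.HeisenbergGroup.SymplecticMatrix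
open Literature.NumberTheory.Automorphic Literature.NumberTheory.Automorphic.UnitaryGroup Literature.NumberTheory.Weil1964
open Literature.NumberTheory.GaloisRepresentations Literature.NumberTheory.GaloisRepresentations.IsNonarchimedeanLocalField
open Literature.RepresentationTheory.HarrisKudlaSweet1996
open Literature.NumberTheory.GelbartRogawski1991 Literature.NumberTheory.GelbartRogawski1991.GRConstruction
open Literature.NumberTheory.GelbartRogawski1991.AdaptedBlocks
open Literature.NumberTheory.GelbartRogawski1991.UnitaryDualPair
open Literature.NumberTheory.GelbartRogawski1991.UnitaryDualPair.LocalSplitting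
open Literature.NumberTheory.GelbartRogawski1991.UnitaryDualPair.LocalSplitting.FrameTransport
open Literature.NumberTheory.GelbartRogawski1991.UnitaryDualPair.LocalSplitting.DoubledBlock
open Literature.NumberTheory.K2Lit.SiegelDoubled Literature.NumberTheory.K2Lit.LocalSiegelDoubled
open Summit.HodgeConjecture.HodgeConjecture.Cruxes.HLiu418.K2LiuLocalSWSectionDefs
open Summit.HodgeConjecture.HodgeConjecture.Cruxes.HLiu418.K2LiuLocalSWTensorBlockTransport
open Summit.HodgeConjecture.HodgeConjecture.Cruxes.HLiu418.K2LiuLocalSWTensorBlockFrame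
open Summit.HodgeConjecture.HodgeConjecture.Cruxes.HLiu418.K2LiuLocalSWTensorBigCellLetters
open Summit.HodgeConjecture.HodgeConjecture.Cruxes.HLiu418.K2LiuLocalSiegelIwasawa (antidiagonal_over_eq_map)
open Summit.HodgeConjecture.HodgeConjecture.Cruxes.HLiu418.K2LiuDoubledUTwoTwoBorelFrame (uLongTwo)
open Summit.HodgeConjecture.HodgeConjecture.Cruxes.HLiu418.K2LiuDoubledUTwoTwoWeylCocycle (weylTwo)
open Summit.HodgeConjecture.HodgeConjecture.Cruxes.HLiu418.K2LiuDoubledUTwoTwoFrameTransport (toLocalFour)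
open Summit.HodgeConjecture.HodgeConjecture.Cruxes.HLiu418.K2LiuSiegelLeviWeylAlgebra (conj_nElem_mem_unipDeltaLocal blkB_matA_conj_nElem)
open Summit.HodgeConjecture.HodgeConjecture.Cruxes.HLiu418.K2LiuUnipDeltaLocalCoordinates (skew_blkB_of_mem_unipDeltaLocal)
open Summit.HodgeConjecture.HodgeConjecture.Cruxes.HLiu418.K2LiuLocalFourCornerFactorisation
open Summit.HodgeConjecture.HodgeConjecture.Cruxes.HLiu418.K2LiuLocalFourCornerFrameOfRecord (blkA_blkD_flip_mul_frameConj_weylTwo)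
open Summit.HodgeConjecture.HodgeConjecture.Cruxes.HLiu418.K2LiuLocalSWCornerActionWords (exists_ne_zero_swSectionTensorLoc_flip_siegel_nElem_mul_eq_integral)

namespace Summit.HodgeConjecture.HodgeConjecture.Cruxes.HLiu418.K2LiuLocalSWCornerActionWordsYStage

/-! ## §0 The flip currency: `single` form ↔ [A1-mat]'s explicit form at the line `1 : Fin 2` -/

/-- the flip of the second line in the two currencies: `[[1 − E₂₂, E₂₂], [E₂₂, 1 − E₂₂]] = [[(1 0; 0 0), (0 0; 0 1)], [(0 0; 0 1), (1 0; 0 0)]]`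
(★ `exists_flip_single` ∕ ★ `exists_flip_single_hermD` at `i := 1` versus ★ [A1-mat] §3's `hw₁`). [folklore] -/
theorem fromBlocks_one_sub_single_one {R : Type*} [Ring R] :
    (Matrix.fromBlocks (1 - Matrix.single (1 : Fin 2) (1 : Fin 2) (1 : R)) (Matrix.single 1 1 1) (Matrix.single 1 1 1) (1 - Matrix.single 1 1 1) :
        Matrix (Fin 2 ⊕ Fin 2) (Fin 2 ⊕ Fin 2) R) =
      Matrix.fromBlocks !![1, 0; 0, 0] !![0, 0; 0, 1] !![0, 0; 0, 1] !![1, 0; 0, 0] := by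
  have hP : (Matrix.single (1 : Fin 2) (1 : Fin 2) (1 : R)) = !![0, 0; 0, 1] := by
    ext i j; fin_cases i <;> fin_cases j <;> simp [Matrix.single]
  have hQ : (1 : Matrix (Fin 2) (Fin 2) R) - !![0, 0; 0, 1] = !![1, 0; 0, 0] := by
    ext i j; fin_cases i <;> fin_cases j <;> simp
  rw [hP, hQ]

variable (L : Type) [Field L] [NumberField L] [IsCMField L]
variable {N M : ℕ} (e : Fin N × Fin M ≃ Fin 2)
  (dV : Fin N → L) (hdV : ∀ i, IsCMField.complexConj L (dV i) = dV i)
  (dW : Fin M → L) (hdW : ∀ i, IsCMField.complexConj L (dW i) = dW i)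
variable {M₂ M' : ℕ} (eW : Fin M × Fin M₂ ≃ Fin M') (e' : Fin N × Fin M' ≃ Fin (M₂ + M₂))
  (dV' : Fin M₂ → L) (hdV' : ∀ k, IsCMField.complexConj L (dV' k) = dV' k)
  (v : HeightOneSpectrum (𝓞 (Fp L)))
  [MeasurableSpace (v.adicCompletion (Fp L))] [BorelSpace (v.adicCompletion (Fp L))]
  (μ : Measure (v.adicCompletion (Fp L))) [μ.IsAddHaarMeasure]
  (χ : HeckeCharacter L) (hχ : IsSplittingChar L 1 χ)
  -- the antidiagonal frame of the small doubled group `U(𝕍^𝔻)(L⁺_v)` ([A1-mat]; ★ `exists_antidiagFrame` at the diagonal Gram of record)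
  (D Dinv : Matrix (Fin 2) (Fin 2) (Fp L)) (hDD : D * Dinv = 1) (Q : GL (Fin (2 + 2)) (Fp L))
  (hQm : (Q : Matrix (Fin (2 + 2)) (Fin (2 + 2)) (Fp L)) = Matrix.reindex (e₂ 2) (e₂ 2) (Matrix.fromBlocks 1 D 1 (-D)))
  (hQ : (Q : Matrix (Fin (2 + 2)) (Fin (2 + 2)) (Fp L))ᵀ * gramD (Fp L) 2 (gramR L e dV hdV dW hdW) * (Q : Matrix (Fin (2 + 2)) (Fin (2 + 2)) (Fp L)) =
    (StdForm.antidiagonal (2 + 2)).over (Fp L))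
  {d₁ d₂ d₁' d₂' : Fp L} (hDa : D = !![0, d₁; d₂, 0]) (hDia : Dinv = !![0, d₁'; d₂', 0])
  -- a flip of the second line, in the tree's `single` currency (★ `exists_flip_single_hermD … 1`)
  {w₁ : UnitaryGroup.localPi L (IsCMField.complexConj L) (2 + 2) (hermD L e dV hdV dW hdW) v}
  (hw₁ : adapt (matA (Fp L) L (IsCMField.complexConj L) v 2 w₁) =
    Matrix.fromBlocks (1 - Matrix.single 1 1 1) (Matrix.single 1 1 1) (Matrix.single 1 1 1) (1 - Matrix.single 1 1 1))

/-! ## §1 The Levi factor `w₁ · φ(w₂)`: Siegel key, and the closed form of the conjugated skew `A · t_x · D⁻¹` -/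

omit [MeasurableSpace (v.adicCompletion (Fp L))] [BorelSpace (v.adicCompletion (Fp L))] in
include hDD hQm hDa hDia hw₁ in
/-- **`w₁ · φ(w₂) ∈ P_Δ(L⁺_v)` as the `blkC` key**: `blkC (matA (w₁ · φ(w₂))) = 0` (the `hmC` of ★ [A1] §3; ★ `adapt_matA_flip_mul_frameConj_weylTwo`).
[cite: HarrisKudlaSweet1996, §1 (1.12), (1.15)] [cite: Kudla1994, §3] -/
theorem blkC_matA_flip_mul_frameConj_weylTwo :
    blkC (matA (Fp L) L (IsCMField.complexConj L) v 2 (w₁ *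
      FrameTransport.frameConj (Fp L) L (IsCMField.complexConj L) v (2 + 2) (hermD_eq_map_gramD L e dV hdV dW hdW) (antidiagonal_over_eq_map (Fp L) L 2) Q hQ
        (toLocalFour (Fp L) L (IsCMField.complexConj L) v
          (weylTwo (UnitaryGroup.LocalRing L v) (UnitaryGroup.conjLocal L (IsCMField.complexConj L) v))))) = 0 := by
  have h := adapt_matA_flip_mul_frameConj_weylTwo (Fp L) L (IsCMField.complexConj L) v (hermD_eq_map_gramD L e dV hdV dW hdW) D Dinv hDD Q hQm hQ
    hDa hDia w₁ (hw₁.trans fromBlocks_one_sub_single_one)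
  rw [adapt_eq] at h
  exact (Matrix.fromBlocks_inj.1 h).2.2.1

set_option maxHeartbeats 400000 in
omit [MeasurableSpace (v.adicCompletion (Fp L))] [BorelSpace (v.adicCompletion (Fp L))] in
include hDD hQm hDa hDia hw₁ in
/-- **THE CONJUGATED SKEW IN CLOSED FORM: `A · t_x · D⁻¹ = (0 0; 0 ι(d₂)·x)`** for `A = blkA`, `D = blkD` of `w₁ · φ(w₂)` (`= diag(1, ι d₂)`, `diag(1, ι d₁′)`,
★ `blkA_blkD_flip_mul_frameConj_weylTwo`) and `t_x = E₂₁(x) · Dinv_v` (the skew of `φ(u_{2e₂}(x)) = n(t_x)`, ★ `frameConj_uLongTwo_eq_nElem`); `d₂ d₁′ = 1` by `D · Dinv = 1`.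
[cite: HarrisKudlaSweet1996, §1 (1.11)–(1.12)] [cite: Kudla1994, §3] -/
theorem blkA_mul_uLongTwoBlock_mul_blkD_inv (x : UnitaryGroup.LocalRing L v) :
    blkA (matA (Fp L) L (IsCMField.complexConj L) v 2 (w₁ *
        FrameTransport.frameConj (Fp L) L (IsCMField.complexConj L) v (2 + 2) (hermD_eq_map_gramD L e dV hdV dW hdW) (antidiagonal_over_eq_map (Fp L) L 2) Q hQ
          (toLocalFour (Fp L) L (IsCMField.complexConj L) v
            (weylTwo (UnitaryGroup.LocalRing L v) (UnitaryGroup.conjLocal L (IsCMField.complexConj L) v))))) *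
        (!![0, 0; x, 0] * Dinv.map ((UnitaryGroup.toLocalRing L v).comp (algebraMap (Fp L) (v.adicCompletion (Fp L))))) *
      (blkD (matA (Fp L) L (IsCMField.complexConj L) v 2 (w₁ *
        FrameTransport.frameConj (Fp L) L (IsCMField.complexConj L) v (2 + 2) (hermD_eq_map_gramD L e dV hdV dW hdW) (antidiagonal_over_eq_map (Fp L) L 2) Q hQ
          (toLocalFour (Fp L) L (IsCMField.complexConj L) v
            (weylTwo (UnitaryGroup.LocalRing L v) (UnitaryGroup.conjLocal L (IsCMField.complexConj L) v))))))⁻¹ =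
      !![0, 0; 0, (UnitaryGroup.toLocalRing L v).comp (algebraMap (Fp L) (v.adicCompletion (Fp L))) d₂ * x] := by
  obtain ⟨hA, hD⟩ := blkA_blkD_flip_mul_frameConj_weylTwo (Fp L) L (IsCMField.complexConj L) v (hermD_eq_map_gramD L e dV hdV dW hdW) D Dinv hDD Q hQm hQ
    hDa hDia w₁ (hw₁.trans fromBlocks_one_sub_single_one)
  -- `d₂ d₁′ = 1` (the `(1,1)` entry of `D · Dinv = 1`), mapped to `L_v`
  have hde : (UnitaryGroup.toLocalRing L v).comp (algebraMap (Fp L) (v.adicCompletion (Fp L))) d₁' *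
      (UnitaryGroup.toLocalRing L v).comp (algebraMap (Fp L) (v.adicCompletion (Fp L))) d₂ = 1 := by
    have h := congrFun (congrFun hDD 1) 1
    rw [hDa, hDia] at h
    have h' : d₂ * d₁' = 1 := by simpa [Matrix.mul_apply, Fin.sum_univ_two] using h
    rw [← map_mul, mul_comm, h', map_one]
  have hDinv : (!![1, 0; 0, (UnitaryGroup.toLocalRing L v).comp (algebraMap (Fp L) (v.adicCompletion (Fp L))) d₁'] :
        Matrix (Fin 2) (Fin 2) (UnitaryGroup.LocalRing L v))⁻¹ =
      !![1, 0; 0, (UnitaryGroup.toLocalRing L v).comp (algebraMap (Fp L) (v.adicCompletion (Fp L))) d₂] := by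
    refine Matrix.inv_eq_right_inv ?_
    ext i j : 1
    fin_cases i <;> fin_cases j <;> simp [Matrix.mul_apply, Fin.sum_univ_two]
    simpa only [RingHom.coe_comp, Function.comp_apply] using hde
  have hDi : Dinv.map ((UnitaryGroup.toLocalRing L v).comp (algebraMap (Fp L) (v.adicCompletion (Fp L)))) =
      !![0, (UnitaryGroup.toLocalRing L v).comp (algebraMap (Fp L) (v.adicCompletion (Fp L))) d₁';
        (UnitaryGroup.toLocalRing L v).comp (algebraMap (Fp L) (v.adicCompletion (Fp L))) d₂', 0] := by
    rw [hDia]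
    ext i j : 1
    fin_cases i <;> fin_cases j <;> simp
  rw [hA, hD, hDinv, hDi]
  ext i j : 1
  fin_cases i <;> fin_cases j <;> simp [Matrix.mul_apply, Fin.sum_univ_two]
  -- the `(1,1)` entry: `ι d₂ · (x · ι d₁′) · ι d₂ = ι d₂ · x`
  linear_combination ((UnitaryGroup.toLocalRing L v).comp (algebraMap (Fp L) (v.adicCompletion (Fp L))) d₂ * x) * hde

omit [MeasurableSpace (v.adicCompletion (Fp L))] [BorelSpace (v.adicCompletion (Fp L))] in
include hDD Q hQm hQ hDa hDia hw₁ in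
/-- **the closed form `(0 0; 0 ι(d₂)·x)` is `gramS`-skew** (it is the corner `B` of `m · n(t_x) · m⁻¹ ∈ N_Δ(L⁺_v)`, `m = w₁ · φ(w₂)`: ★ `conj_nElem_mem_unipDeltaLocal`,
★ `skew_blkB_of_mem_unipDeltaLocal`, ★ `blkB_matA_conj_nElem`) — the `ht` input of ★ `K2LiuTensorMiddleCellSiegelLetters.exists_blockSkew` that supplies the
block-side letter `t′` below. [cite: HarrisKudlaSweet1996, §1 (1.11)–(1.12)] [cite: Kudla1994, §3] -/
theorem skew_cornerYBlock (x : UnitaryGroup.LocalRing L v) (hx : UnitaryGroup.conjLocal L (IsCMField.complexConj L) v x = -x) :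
    ((!![0, 0; 0, (UnitaryGroup.toLocalRing L v).comp (algebraMap (Fp L) (v.adicCompletion (Fp L))) d₂ * x] :
          Matrix (Fin 2) (Fin 2) (UnitaryGroup.LocalRing L v)).map (conjLocal L (IsCMField.complexConj L) v))ᵀ *
        gramS (Fp L) L v 2 (gramR L e dV hdV dW hdW) +
      gramS (Fp L) L v 2 (gramR L e dV hdV dW hdW) *
        !![0, 0; 0, (UnitaryGroup.toLocalRing L v).comp (algebraMap (Fp L) (v.adicCompletion (Fp L))) d₂ * x] = 0 := by
  have hmC := blkC_matA_flip_mul_frameConj_weylTwo L e dV hdV dW hdW v D Dinv hDD Q hQm hQ hDa hDia hw₁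
  have ht := skew_uLongTwoBlock (Fp L) L (IsCMField.complexConj L) v (hermD_eq_map_gramD L e dV hdV dW hdW) D Dinv hDD Q hQm hQ x hx
  have h := skew_blkB_of_mem_unipDeltaLocal (Fp L) L (IsCMField.complexConj L) v 2 (hermD_eq_map_gramD L e dV hdV dW hdW)
    (conj_nElem_mem_unipDeltaLocal (Fp L) L (IsCMField.complexConj L) v 2 (hermD_eq_map_gramD L e dV hdV dW hdW) hmC ht)
  rwa [blkB_matA_conj_nElem (Fp L) L (IsCMField.complexConj L) v 2 (hermD_eq_map_gramD L e dV hdV dW hdW) hmC ht,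
    blkA_mul_uLongTwoBlock_mul_blkD_inv L e dV hdV dW hdW v D Dinv hDD Q hQm hQ hDa hDia hw₁ x] at h

/-! ## §2 The y-stage corner pair by name -/

set_option maxHeartbeats 4000000 in -- as ★ [A1] §3 (measured there: 1600000 RED; the section vector carries the tensor datum a second time)
include hDD hQm hDa hDia hw₁ in
/-- **[A1] THE y-STAGE CORNER PAIR BY NAME: `F_Φ(φ(w₂) · φ(u_{2e₂}(x)) · g)`.**  With ★ (M2a-C2a)'s data VERBATIM at the lines `(i₀, i₁) = (1, 0)`, the
antidiagonal frame `(D, Dinv, Q)` of [A1-mat] and a flip `w₁` of the second line, there is ONE `c ≠ 0` with, for every `x ∈ L_v` with `x̄ = −x`, every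
block-side skew `t′` keyed by `P_v · t′ · P_v⁻¹ = reindex_ε ((0 0; 0 ι(d₂)·x) ⊗ 1)` (★ `exists_blockSkew` on `skew_cornerYBlock`), every `g` and every `Φ`:
`F_Φ(φ(w₂) · φ(u_{2e₂}(x)) · g) = c · ∫_{X₁} (unipOpPi c_{t′} (op(j̃(p₁,p₂)) (frameOp_{PD}⁻¹ (ω(s′(tensorEmbLoc ((w₁ · φ(w₂)) · g))) Φ))))(x₁ ⊔ 0) dμ^{⊗(M₂+M₂)}` —
`φ(w₂) = w₁ · (w₁ · φ(w₂))` (★ `flip_mul_self`), `φ(u_{2e₂}(x)) = n(t_x)` (★ `frameConj_uLongTwo_eq_nElem`), `A t_x D⁻¹ = (0 0; 0 ι(d₂)x)` (§1), then ★ [A1] §3.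
[cite: Kudla1994, §3 Thm. 3.1] [cite: HarrisKudlaSweet1996, §1 (1.11)–(1.12), (1.15)] [cite: MoeglinVignerasWaldspurger1987, Chap. 2 II.1 Rem. (3), (6), II.6]
[cite: Rangarao1993, Lemma 3.2 (3.8), p. 351] -/
theorem exists_ne_zero_swSectionTensorLoc_weylTwo_uLongTwo_mul_eq_integral (hM₂ : 0 < M₂ + M₂)
    (hT₀d : IsUnit (gramR L e' dV hdV (tensorFrame L dW eW dV') (tensorFrame_real L dW hdW eW dV' hdV')).det)
    {σ : Equiv.Perm (Fin (M₂ + M₂))}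
    (hσ₀ : ∀ k, σ (epsV e eW e' (1, k)) = finSumFinEquiv (Sum.inl k)) (hσ₁ : ∀ k, σ (epsV e eW e' (0, k)) = finSumFinEquiv (Sum.inr k))
    {T₁ T₂ : Matrix (Fin M₂) (Fin M₂) (Fp L)}
    (P : GL (Fin (M₂ + M₂)) (Fp L)) (hPσ : (P : Matrix (Fin (M₂ + M₂)) (Fin (M₂ + M₂)) (Fp L)) = σ.toPEquiv.toMatrix)
    (hP : ((P : Matrix (Fin (M₂ + M₂)) (Fin (M₂ + M₂)) (Fp L)))ᵀ *
        gramR L e' dV hdV (tensorFrame L dW eW dV') (tensorFrame_real L dW hdW eW dV' hdV') * (P : Matrix _ _ (Fp L)) =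
      UnitaryGroup.finSum M₂ M₂ T₁ T₂)
    (t' : Fin (M₂ + M₂) → Fp L) (hT' : UnitaryGroup.finSum M₂ M₂ T₁ T₂ = Matrix.diagonal t') (hT₀'d : IsUnit (UnitaryGroup.finSum M₂ M₂ T₁ T₂).det)
    {PD : GL (Fin ((M₂ + M₂) + (M₂ + M₂))) (Fp L)} (hPD : PD = UnitaryGroup.reindexGL (e₂ (M₂ + M₂)) (UnitaryGroup.blockDiagGL (P, P)))
    (m₀ : LocalMp (Fp L) ((M₂ + M₂) + (M₂ + M₂))
      (gramD (Fp L) (M₂ + M₂) (gramR L e' dV hdV (tensorFrame L dW eW dV') (tensorFrame_real L dW hdW eW dV' hdV'))) v)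
    (hm₀ : (deltaLagrangian (Fp L) v (M₂ + M₂)).map (toLin (Fp L) v (MpPsi.proj _ m₀)) = lagrangianY (Fp L) ((M₂ + M₂) + (M₂ + M₂)) v)
    -- the block data of (M2a-C1)
    (hM₂' : 0 < M₂) (t₁ : Fin M₂ → Fp L) (hT₁t : T₁ = Matrix.diagonal t₁) (hT₁ : T₁.IsSymm) (hT₂ : T₂.IsSymm)
    (hT₁d : IsUnit T₁.det) (hT₂d : IsUnit T₂.det)
    (hTv₁ : IsUnit (localGram (Fp L) (M₂ + M₂) (gramD (Fp L) M₂ T₁) v).det)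
    (p₁ : LocalMp (Fp L) (M₂ + M₂) (gramD (Fp L) M₂ T₁) v)
    (hp₁ : (deltaLagrangian (Fp L) v M₂).map (toLin (Fp L) v (MpPsi.proj _ p₁)) = lagrangianY (Fp L) (M₂ + M₂) v)
    (B₁ : GL (Fin (M₂ + M₂)) (v.adicCompletion (Fp L)))
    (hW₁ : MpPsi.proj _ p₁ * iotaD (Fp L) L (IsCMField.complexConj L) (complexConj_imagUnit L) (imagUnit_ne_zero L)
        (imagUnit_mul_self L) v M₂ hT₁ rfl (weylDelta (Fp L) L (IsCMField.complexConj L) v M₂ (T₀ := T₁) rfl) * (MpPsi.proj _ p₁)⁻¹ =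
      (transportSp (localGram (Fp L) (M₂ + M₂) (gramD (Fp L) M₂ T₁) v) hTv₁ (SymplecticGroup.symJ _ _))⁻¹ *
        transportSp (localGram (Fp L) (M₂ + M₂) (gramD (Fp L) M₂ T₁) v) hTv₁ (levi B₁))
    {m : ℤ} (hm : (adeleAddCharAt (Fp L) v).HasConductorExp m)
    (p₂ : LocalMp (Fp L) (M₂ + M₂) (gramD (Fp L) M₂ T₂) v)
    (hp₂ : (deltaLagrangian (Fp L) v M₂).map (toLin (Fp L) v (MpPsi.proj _ p₂)) = lagrangianY (Fp L) (M₂ + M₂) v) :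
    ∃ c : ℂ, c ≠ 0 ∧ ∀ (x : UnitaryGroup.LocalRing L v) (hx : UnitaryGroup.conjLocal L (IsCMField.complexConj L) v x = -x)
      (tb : Matrix (Fin (M₂ + M₂)) (Fin (M₂ + M₂)) (LocalRing L v))
      (htb : (tb.map (conjLocal L (IsCMField.complexConj L) v))ᵀ * gramS (Fp L) L v (M₂ + M₂) (UnitaryGroup.finSum M₂ M₂ T₁ T₂) +
        gramS (Fp L) L v (M₂ + M₂) (UnitaryGroup.finSum M₂ M₂ T₁ T₂) * tb = 0)
      (_hPX : (P : Matrix (Fin (M₂ + M₂)) (Fin (M₂ + M₂)) (Fp L)).map ((UnitaryGroup.toLocalRing L v).comp (algebraMap (Fp L) (v.adicCompletion (Fp L)))) * tb *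
        ((P⁻¹ : GL (Fin (M₂ + M₂)) (Fp L)) : Matrix (Fin (M₂ + M₂)) (Fin (M₂ + M₂)) (Fp L)).map
          ((UnitaryGroup.toLocalRing L v).comp (algebraMap (Fp L) (v.adicCompletion (Fp L)))) =
        Matrix.reindex (epsV e eW e') (epsV e eW e')
          (!![0, 0; 0, (UnitaryGroup.toLocalRing L v).comp (algebraMap (Fp L) (v.adicCompletion (Fp L))) d₂ * x] ⊗ₖ
            (1 : Matrix (Fin M₂) (Fin M₂) (LocalRing L v))))
      (g : UnitaryGroup.localPi L (IsCMField.complexConj L) (2 + 2) (hermD L e dV hdV dW hdW) v)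
      (Φ : SchwartzBruhat (Fin ((M₂ + M₂) + (M₂ + M₂)) → v.adicCompletion (Fp L))),
      swSectionTensorLoc L e dV hdV dW hdW eW e' dV' hdV' v
          (localSplittingDatumCM L v μ (M₂ + M₂)
            (gramR_isSymm L e' dV hdV (tensorFrame L dW eW dV') (tensorFrame_real L dW hdW eW dV' hdV')) hT₀d
            (hermD_eq_map_gramD L e' dV hdV (tensorFrame L dW eW dV') (tensorFrame_real L dW hdW eW dV' hdV')) χ hχ).localSplitting
          m₀ Φ
          (FrameTransport.frameConj (Fp L) L (IsCMField.complexConj L) v (2 + 2) (hermD_eq_map_gramD L e dV hdV dW hdW) (antidiagonal_over_eq_map (Fp L) L 2) Q hQ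
              (toLocalFour (Fp L) L (IsCMField.complexConj L) v
                (weylTwo (UnitaryGroup.LocalRing L v) (UnitaryGroup.conjLocal L (IsCMField.complexConj L) v))) *
            FrameTransport.frameConj (Fp L) L (IsCMField.complexConj L) v (2 + 2) (hermD_eq_map_gramD L e dV hdV dW hdW) (antidiagonal_over_eq_map (Fp L) L 2) Q hQ
              (toLocalFour (Fp L) L (IsCMField.complexConj L) v
                (uLongTwo (UnitaryGroup.LocalRing L v) (UnitaryGroup.conjLocal L (IsCMField.complexConj L) v) x hx)) * g) =
        c * ∫ x₁ : Fin (M₂ + M₂) → v.adicCompletion (Fp L),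
          ((unipOpPi (isLocallyConstant_of_isContinuousNontrivial (isContinuousNontrivial_adeleAddCharAt (Fp L) v))
            (Matrix.mulVecLin (cOfFix (localGram (Fp L) ((M₂ + M₂) + (M₂ + M₂)) (gramD (Fp L) (M₂ + M₂) (UnitaryGroup.finSum M₂ M₂ T₁ T₂)) v)
              (MpPsi.proj _ (boxLoc (Fp L) v M₂ M₂ (T₁ := T₁) (T₂ := T₂) (p₁, p₂)) *
                iotaD (Fp L) L (IsCMField.complexConj L) (complexConj_imagUnit L) (imagUnit_ne_zero L) (imagUnit_mul_self L) v
                  (M₂ + M₂) (UnitaryGroup.isSymm_finSum hT₁ hT₂) rfl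
                  (nElem (Fp L) L (IsCMField.complexConj L) v (M₂ + M₂) (T₀ := UnitaryGroup.finSum M₂ M₂ T₁ T₂) rfl tb htb) *
                (MpPsi.proj _ (boxLoc (Fp L) v M₂ M₂ (T₁ := T₁) (T₂ := T₂) (p₁, p₂)))⁻¹)))
            (MpPsi.toOp _ (boxLoc (Fp L) v M₂ M₂ (T₁ := T₁) (T₂ := T₂) (p₁, p₂))
              ((frameOp (Fp L) v ((M₂ + M₂) + (M₂ + M₂)) PD).symm
                (MpPsi.toRep (localSchrodinger (Fp L) ((M₂ + M₂) + (M₂ + M₂))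
                  (gramD (Fp L) (M₂ + M₂) (gramR L e' dV hdV (tensorFrame L dW eW dV') (tensorFrame_real L dW hdW eW dV' hdV'))) v)
                ((localSplittingDatumCM L v μ (M₂ + M₂)
                  (gramR_isSymm L e' dV hdV (tensorFrame L dW eW dV') (tensorFrame_real L dW hdW eW dV' hdV')) hT₀d
                  (hermD_eq_map_gramD L e' dV hdV (tensorFrame L dW eW dV') (tensorFrame_real L dW hdW eW dV' hdV')) χ hχ).localSplitting
                  (tensorEmbLoc L e dV hdV dW hdW eW e' dV' hdV' v
                    (w₁ * FrameTransport.frameConj (Fp L) L (IsCMField.complexConj L) v (2 + 2) (hermD_eq_map_gramD L e dV hdV dW hdW)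
                        (antidiagonal_over_eq_map (Fp L) L 2) Q hQ
                        (toLocalFour (Fp L) L (IsCMField.complexConj L) v
                          (weylTwo (UnitaryGroup.LocalRing L v) (UnitaryGroup.conjLocal L (IsCMField.complexConj L) v))) * g))) Φ))) :
              SchwartzBruhat (Fin ((M₂ + M₂) + (M₂ + M₂)) → v.adicCompletion (Fp L))) :
            (Fin ((M₂ + M₂) + (M₂ + M₂)) → v.adicCompletion (Fp L)) → ℂ)
            (glue (blkIdx M₂ M₂) x₁ (0 : Fin (M₂ + M₂) → v.adicCompletion (Fp L))) ∂(Measure.pi fun _ => μ) := by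
  have hmC := blkC_matA_flip_mul_frameConj_weylTwo L e dV hdV dW hdW v D Dinv hDD Q hQm hQ hDa hDia hw₁
  obtain ⟨c, hc, h⟩ := exists_ne_zero_swSectionTensorLoc_flip_siegel_nElem_mul_eq_integral L e dV hdV dW hdW eW e' dV' hdV' v μ χ hχ hM₂ hT₀d
    (show (1 : Fin 2) ≠ 0 by decide) hσ₀ hσ₁ P hPσ hP t' hT' hT₀'d hPD m₀ hm₀ hw₁ hM₂' t₁ hT₁t hT₁ hT₂ hT₁d hT₂d hTv₁ p₁ hp₁ B₁ hW₁ hm p₂ hp₂ hmC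
  refine ⟨c, hc, fun x hx tb htb hPX g Φ => ?_⟩
  have ht := skew_uLongTwoBlock (Fp L) L (IsCMField.complexConj L) v (hermD_eq_map_gramD L e dV hdV dW hdW) D Dinv hDD Q hQm hQ x hx
  have hkey := blkA_mul_uLongTwoBlock_mul_blkD_inv L e dV hdV dW hdW v D Dinv hDD Q hQm hQ hDa hDia hw₁ x
  -- the `m`-conjugate `A t_x D⁻¹` is skew, and the block-side letter reads it (both through the closed form of §1)
  have hAtD := skew_cornerYBlock L e dV hdV dW hdW v D Dinv hDD Q hQm hQ hDa hDia hw₁ x hx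
  rw [← hkey] at hAtD
  have hPX' := hPX
  rw [← hkey] at hPX'
  -- `φ(w₂) · φ(u_{2e₂}(x)) · g = w₁ · (w₁ · φ(w₂)) · n(t_x) · g`
  have hφ : FrameTransport.frameConj (Fp L) L (IsCMField.complexConj L) v (2 + 2) (hermD_eq_map_gramD L e dV hdV dW hdW) (antidiagonal_over_eq_map (Fp L) L 2) Q hQ
          (toLocalFour (Fp L) L (IsCMField.complexConj L) v
            (weylTwo (UnitaryGroup.LocalRing L v) (UnitaryGroup.conjLocal L (IsCMField.complexConj L) v))) *
        FrameTransport.frameConj (Fp L) L (IsCMField.complexConj L) v (2 + 2) (hermD_eq_map_gramD L e dV hdV dW hdW) (antidiagonal_over_eq_map (Fp L) L 2) Q hQ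
          (toLocalFour (Fp L) L (IsCMField.complexConj L) v
            (uLongTwo (UnitaryGroup.LocalRing L v) (UnitaryGroup.conjLocal L (IsCMField.complexConj L) v) x hx)) * g =
      w₁ * (w₁ * FrameTransport.frameConj (Fp L) L (IsCMField.complexConj L) v (2 + 2) (hermD_eq_map_gramD L e dV hdV dW hdW)
          (antidiagonal_over_eq_map (Fp L) L 2) Q hQ
          (toLocalFour (Fp L) L (IsCMField.complexConj L) v
            (weylTwo (UnitaryGroup.LocalRing L v) (UnitaryGroup.conjLocal L (IsCMField.complexConj L) v)))) *
        nElem (Fp L) L (IsCMField.complexConj L) v 2 (T₀ := gramR L e dV hdV dW hdW) (hermD_eq_map_gramD L e dV hdV dW hdW)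
          (!![0, 0; x, 0] * Dinv.map ((UnitaryGroup.toLocalRing L v).comp (algebraMap (Fp L) (v.adicCompletion (Fp L))))) ht * g := by
    rw [← mul_assoc w₁ w₁, flip_mul_self (Fp L) L (IsCMField.complexConj L) v w₁ (hw₁.trans fromBlocks_one_sub_single_one), one_mul,
      frameConj_uLongTwo_eq_nElem (Fp L) L (IsCMField.complexConj L) v (hermD_eq_map_gramD L e dV hdV dW hdW) D Dinv hDD Q hQm hQ x hx]
  rw [hφ]
  exact h _ ht hAtD tb htb hPX' g Φ

end Summit.HodgeConjecture.HodgeConjecture.Cruxes.HLiu418.K2LiuLocalSWCornerActionWordsYStage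

end
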